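import Summits.ValiantsHypothesis.ValiantsHypothesis.Theorems.LacunarySymmetroidMatrixDescartesCensusSignChangeCount
import Summits.ValiantsHypothesis.ValiantsHypothesis.Theorems.LacunarySymmetroidMatrixDescartesCensusWindowSupportCard
import Summits.ValiantsHypothesis.ValiantsHypothesis.Theorems.LacunarySymmetroidMatrixDescartesCensusFullAlternation
import Summits.ValiantsHypothesis.ValiantsHypothesis.Theorems.LacunarySymmetroidMatrixDescartesCensusDefs
import Summits.ValiantsHypothesis.ValiantsHypothesis.Theorems.SymmetroidPencilBasics

/-!
# `MatrixDescartes` census — the A′ BRIDGE: an alternating (2,6) nineteen lifts to a twenty on the SAME support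

HONEST FRAMING.  Object-search cell `pub-symmetroid`, route `LacunarySymmetroid`; door-A item
`Theses.LacunarySymmetroid.DoorA26` (stmt-ValiantsHypothesis-19979, `= PosRootLawAt 2 6 19`) and its sharper support rows
`PosRootLawOn 2 6 18 d` (the V = 19 layer).  Engine-3 g15's exhaustive sub-case split of a HYPOTHETICAL (2,6) nineteen
(READOUT-g15 §3): a real symmetric `2 × 2` six-term pencil with `19` distinct positive det-roots is (A) one-slack on a
2-Sidon support, or (A′) fully alternating with ONE DOUBLE ROOT (`21` non-zero pair-sum coefficients, `Var = 20`,
`20` roots with multiplicity), or (B) has exactly one vanishing coefficient, or (C) lives on a one-collision support.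
This file closes sub-case (A′) in the kernel ONCE FOR ALL SUPPORTS, by reduction to the V = 20 layer:

* `exists_twenty_of_nineteen_of_countP` — if `det (Σ_l X^{d l} S l)` (`S l` symmetric) has `≥ 19` DISTINCT positive
  roots and `≥ 20` counted WITH MULTIPLICITY, then some symmetric pencil ON THE SAME exponent vector `d` has `≥ 20`
  distinct positive det-roots.  Proof: `#supp det ≤ 21` and Descartes force the multiplicity count to be exactly `20`;
  the double root is split by the one-letter deformation `S 0 ↦ S 0 + ε T` (`det` moves by
  `ε x^{d₀}·L_T(F(x)) + ε² x^{2d₀} det T`, and `T` is read off the value `F(r)` of the pencil at the double root so that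
  the first-order term has the required sign — or, if `F(r) = 0`, `det T` has it), via the class-level splitting
  theorem `exists_card_posRoots_of_double_root_deformation` (`…CensusSignChangeCount.lean`).
* `exists_twenty_of_nineteen_of_signVariations` — the same from `Var(det) ≥ 20` (Descartes with parity,
  `Literature…Descartes.signVariations_eq_countP_add_two_mul`).
* `countP_le_nineteen_of_posRootLawOn`, `signVariations_le_nineteen_of_posRootLawOn` — the DOOR-A READING: on every
  support `d` where the V = 20 row `PosRootLawOn 2 6 19 d` is a theorem (BOX20 `Census.doorA26_on_<d>` ×126,
  `Census.doorA26_box20`, the uniform rays `…TNCUnif*`, the record supports), a hypothetical nineteen has multiplicity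
  count `≤ 19` and `Var ≤ 19` — sub-case (A′) is dead there with NO regeneration of any certificate file; what remains
  of `PosRootLawOn 2 6 18 d` on such a support is (A) + (B) (+ (C) off the Sidon class).

Also here: `det_add_smul_fin_two` (`det (A + cT)` for `2 × 2`), `sum_smul_perturb` (the deformed pencil evaluates to
`F(x) + ε x^{d₀} T`).  NOT here: sub-cases (A), (B), (C); any bound on `ζ_sym(2,6)`; `DoorA26` stays OPEN and is asserted
nowhere; nothing on `MatrixDescartes` (stmt-ValiantsHypothesis-18050) or `VP ≠ VNP`.

[folklore] Descartes' rule with parity; transversal splitting of a double root.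
-/

-- `Summit.ValiantsHypothesis.ValiantsHypothesis.…` repeats a component by the D-0017 layout
-- (single-conjunct summit), which the `dupNamespace` linter flags; the name is mandated.
set_option linter.dupNamespace false

namespace Summit.ValiantsHypothesis.ValiantsHypothesis.Theorems.LacunarySymmetroidMatrixDescartes.Census

open Polynomial Finset Filter
open scoped BigOperators Polynomial Matrix Topology
open Summit.ValiantsHypothesis.ValiantsHypothesis.Theorems.MatrixDescartes.Negative (PosRootLawAt)
open Summit.ValiantsHypothesis.ValiantsHypothesis.Theorems.SymmetroidDescartes (eval_det_pencil)

/-- `2 × 2` expansion: `det (A + c·T) = det A + c·(A₀₀T₁₁ + A₁₁T₀₀ − A₀₁T₁₀ − A₁₀T₀₁) + c²·det T`. [folklore] -/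
theorem det_add_smul_fin_two (A T : Matrix (Fin 2) (Fin 2) ℝ) (c : ℝ) :
    (A + c • T).det = A.det + c * (A 0 0 * T 1 1 + A 1 1 * T 0 0 - A 0 1 * T 1 0 - A 1 0 * T 0 1)
      + c ^ 2 * T.det := by
  simp only [Matrix.det_fin_two, Matrix.add_apply, Matrix.smul_apply, smul_eq_mul]
  ring

/-- The deformed letter family `S' l = S l + [l = 0]·εT` evaluates to `F(x) + (ε x^{d 0})·T`. [folklore] -/
theorem sum_smul_perturb (d : Fin 6 → ℕ) (S : Fin 6 → Matrix (Fin 2) (Fin 2) ℝ) (T : Matrix (Fin 2) (Fin 2) ℝ)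
    (ε x : ℝ) :
    (∑ l, x ^ d l • (S l + if l = 0 then ε • T else 0)) = (∑ l, x ^ d l • S l) + (ε * x ^ d 0) • T := by
  have h : ∀ l : Fin 6, x ^ d l • (S l + if l = 0 then ε • T else 0)
      = x ^ d l • S l + (if l = 0 then x ^ d l • (ε • T) else 0) := by
    intro l
    split_ifs <;> simp [smul_add]
  simp_rw [h, Finset.sum_add_distrib, Finset.sum_ite_eq', Finset.mem_univ, if_true, smul_smul, mul_comm ε]

/-- **A′ BRIDGE (multiplicity form).**  Let `f = det (Σ_l X^{d l} S l)` with all `S l` real symmetric `2 × 2`.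
If `f` has at least `19` distinct positive roots and at least `20` positive roots counted with multiplicity, then some
real symmetric pencil `S'` on the SAME exponent vector `d` has at least `20` distinct positive det-roots. [folklore] -/
theorem exists_twenty_of_nineteen_of_countP (d : Fin 6 → ℕ) (S : Fin 6 → Matrix (Fin 2) (Fin 2) ℝ)
    (hS : ∀ l, (S l).IsSymm) {f : ℝ[X]}
    (hf : f = ((∑ l, (X : ℝ[X]) ^ d l • (S l).map C)).det)
    (hZ : 19 ≤ (f.roots.toFinset.filter (fun t => 0 < t)).card)
    (hZm : 20 ≤ f.roots.countP (fun t => 0 < t)) :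
    ∃ S' : Fin 6 → Matrix (Fin 2) (Fin 2) ℝ, (∀ l, (S' l).IsSymm) ∧
      20 ≤ ((((∑ l, (X : ℝ[X]) ^ d l • (S' l).map C)).det).roots.toFinset.filter (fun t => 0 < t)).card := by
  classical
  have hf0 : f ≠ 0 := by rintro rfl; simp at hZ
  -- multiplicity count is exactly 20 (`#supp ≤ 21`, Descartes)
  have hZm20 : f.roots.countP (fun t => 0 < t) = 19 + 1 := by
    have h1 := f.roots_countP_pos_le_signVariations
    have h2 := Literature.Computability.AlgebraicComplexity.signVariations_lt_card_support hf0
    have h3 := card_support_det_two_six_le d S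
    rw [← hf] at h3
    omega
  -- the class: determinants of symmetric pencils on `d`
  let P : ℝ[X] → Prop := fun g => ∃ S' : Fin 6 → Matrix (Fin 2) (Fin 2) ℝ, (∀ l, (S' l).IsSymm) ∧
    g = ((∑ l, (X : ℝ[X]) ^ d l • (S' l).map C)).det
  have hPf : P f := ⟨S, hS, hf⟩
  suffices h : ∃ f' : ℝ[X], P f' ∧ 19 + 1 ≤ (f'.roots.toFinset.filter (fun t => 0 < t)).card by
    obtain ⟨f', ⟨S', hS', rfl⟩, h20⟩ := h
    exact ⟨S', hS', h20⟩
  refine exists_card_posRoots_of_double_root_deformation P f 19 hPf hZ hZm20 ?_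
  -- the deformation at a double root `r`, against a sign `σ`
  intro r hr hm σ hσ
  have hfr : f.eval r = 0 := ((rootMultiplicity_pos hf0).mp (by omega)).eq_zero
  -- evaluation of the pencil
  let A : ℝ → Matrix (Fin 2) (Fin 2) ℝ := fun x => ∑ l, x ^ d l • S l
  have hfA : ∀ x, f.eval x = (A x).det := fun x => by rw [hf]; exact eval_det_pencil S d x
  have hAsymm : ∀ x, (A x) 1 0 = (A x) 0 1 := by
    intro x
    have hsl : ∀ l, S l 1 0 = S l 0 1 := fun l => by
      have h := congrFun (congrFun (hS l) 1) 0
      simpa [Matrix.transpose_apply] using h.symm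
    simp only [A, Matrix.sum_apply, Matrix.smul_apply, smul_eq_mul, hsl]
  let lin : Matrix (Fin 2) (Fin 2) ℝ → ℝ → ℝ := fun T x =>
    (A x) 0 0 * T 1 1 + (A x) 1 1 * T 0 0 - (A x) 0 1 * T 1 0 - (A x) 1 0 * T 0 1
  -- the deformed family for a direction `T`
  let Sp : Matrix (Fin 2) (Fin 2) ℝ → ℝ → Fin 6 → Matrix (Fin 2) (Fin 2) ℝ :=
    fun T ε l => S l + if l = 0 then ε • T else 0
  let g : Matrix (Fin 2) (Fin 2) ℝ → ℝ → ℝ[X] := fun T ε => ((∑ l, (X : ℝ[X]) ^ d l • (Sp T ε l).map C)).det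
  have hg_eval : ∀ T ε x, (g T ε).eval x = f.eval x + (ε * x ^ d 0) * lin T x + (ε * x ^ d 0) ^ 2 * T.det := by
    intro T ε x
    show (((∑ l, (X : ℝ[X]) ^ d l • (Sp T ε l).map C)).det).eval x = _
    rw [eval_det_pencil (Sp T ε) d x, hfA x]
    show (∑ l, x ^ d l • (S l + if l = 0 then ε • T else 0)).det = _
    rw [sum_smul_perturb, det_add_smul_fin_two]
  have hgP : ∀ T, T.IsSymm → ∀ ε, P (g T ε) := by
    intro T hT ε
    refine ⟨Sp T ε, fun l => ?_, rfl⟩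
    show (S l + if l = 0 then ε • T else 0).IsSymm
    split_ifs
    · exact (hS l).add (hT.smul ε)
    · rw [add_zero]; exact hS l
  have hglim : ∀ T x, Tendsto (fun ε => (g T ε).eval x) (𝓝[>] 0) (𝓝 (f.eval x)) := by
    intro T x
    simp_rw [hg_eval T]
    have hc : Continuous (fun ε : ℝ => f.eval x + (ε * x ^ d 0) * lin T x + (ε * x ^ d 0) ^ 2 * T.det) := by
      fun_prop
    have := hc.tendsto 0
    simp only [zero_mul, ne_eq, OfNat.ofNat_ne_zero, not_false_eq_true, zero_pow, add_zero] at this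
    exact this.mono_left nhdsWithin_le_nhds
  -- it remains to choose `T` with the required sign at `r`
  suffices hT : ∃ T : Matrix (Fin 2) (Fin 2) ℝ, T.IsSymm ∧
      ∀ᶠ ε in 𝓝[>] (0 : ℝ), ((ε * r ^ d 0) * lin T r + (ε * r ^ d 0) ^ 2 * T.det) * σ < 0 by
    obtain ⟨T, hT, hTr⟩ := hT
    refine ⟨g T, hgP T hT, hglim T, ?_⟩
    filter_upwards [hTr] with ε hε
    rwa [hg_eval, hfr, zero_add]
  have hc0 : 0 < r ^ d 0 := pow_pos hr _
  by_cases hA : A r = 0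
  · -- `F(r) = 0`: the first-order term vanishes; use `det T = −σ`
    refine ⟨!![1, 0; 0, -σ], Matrix.IsSymm.ext (by intro i j; fin_cases i <;> fin_cases j <;> simp), ?_⟩
    have hlin : lin !![1, 0; 0, -σ] r = 0 := by simp [lin, hA]
    have hdet : Matrix.det !![(1 : ℝ), 0; 0, -σ] = -σ := by simp [Matrix.det_fin_two]
    filter_upwards [self_mem_nhdsWithin] with ε (hε : 0 < ε)
    rw [hlin, hdet, mul_zero, zero_add]
    have : 0 < (ε * r ^ d 0) ^ 2 := by positivity
    nlinarith [mul_pos this (mul_self_pos.mpr hσ)]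
  · -- `F(r) ≠ 0`: `T = −σ·(F₁₁, −F₀₁; −F₀₁, F₀₀)` makes the first-order term `−σ·(F₀₀² + F₁₁² + 2F₀₁²)`
    let a00 := (A r) 0 0
    let a01 := (A r) 0 1
    let a11 := (A r) 1 1
    refine ⟨!![-σ * a11, σ * a01; σ * a01, -σ * a00],
      Matrix.IsSymm.ext (by intro i j; fin_cases i <;> fin_cases j <;> simp), ?_⟩
    have hN : 0 < a00 ^ 2 + a11 ^ 2 + 2 * a01 ^ 2 := by
      have hne : a00 ≠ 0 ∨ a01 ≠ 0 ∨ a11 ≠ 0 := by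
        by_contra hcon
        push Not at hcon
        apply hA
        ext i j
        fin_cases i <;> fin_cases j
        · exact hcon.1
        · exact hcon.2.1
        · show A r 1 0 = 0
          rw [hAsymm r]; exact hcon.2.1
        · exact hcon.2.2
      rcases hne with h | h | h <;> positivity
    have hlin : lin !![-σ * a11, σ * a01; σ * a01, -σ * a00] r = -σ * (a00 ^ 2 + a11 ^ 2 + 2 * a01 ^ 2) := by
      simp only [lin, Matrix.of_apply, Matrix.cons_val', Matrix.cons_val_zero, Matrix.cons_val_one,
        Matrix.empty_val', Matrix.cons_val_fin_one, hAsymm r]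
      ring
    set D := Matrix.det !![-σ * a11, σ * a01; σ * a01, -σ * a00] with hD
    -- the bracket `r^{d₀}·(−σN)·σ + ε·(r^{2d₀} D σ)` tends to a negative number as `ε → 0`
    have hlim : Tendsto (fun ε : ℝ => r ^ d 0 * (-σ * (a00 ^ 2 + a11 ^ 2 + 2 * a01 ^ 2)) * σ
        + ε * ((r ^ d 0) ^ 2 * D * σ)) (𝓝[>] 0)
        (𝓝 (r ^ d 0 * (-σ * (a00 ^ 2 + a11 ^ 2 + 2 * a01 ^ 2)) * σ + 0 * ((r ^ d 0) ^ 2 * D * σ))) := by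
      refine Filter.Tendsto.mono_left ?_ nhdsWithin_le_nhds
      exact tendsto_const_nhds.add (tendsto_id.mul tendsto_const_nhds)
    have hneg : r ^ d 0 * (-σ * (a00 ^ 2 + a11 ^ 2 + 2 * a01 ^ 2)) * σ + 0 * ((r ^ d 0) ^ 2 * D * σ) < 0 := by
      rw [zero_mul, add_zero]
      have : 0 < σ * σ := mul_self_pos.mpr hσ
      nlinarith [mul_pos hc0 (mul_pos hN this)]
    have hev := hlim.eventually (gt_mem_nhds hneg)
    filter_upwards [hev, self_mem_nhdsWithin] with ε hε (hε0 : 0 < ε)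
    rw [hlin]
    have : ((ε * r ^ d 0) * (-σ * (a00 ^ 2 + a11 ^ 2 + 2 * a01 ^ 2)) + (ε * r ^ d 0) ^ 2 * D) * σ
        = ε * (r ^ d 0 * (-σ * (a00 ^ 2 + a11 ^ 2 + 2 * a01 ^ 2)) * σ + ε * ((r ^ d 0) ^ 2 * D * σ)) := by
      ring
    rw [this]
    exact mul_neg_of_pos_of_neg hε0 hε

/-- **A′ BRIDGE (sign-variation form).**  If `f = det (Σ_l X^{d l} S l)` (`S l` symmetric `2 × 2`) has at least `19`
distinct positive roots and `Var(f) ≥ 20` — i.e. all `21` pair-sum coefficients are present and alternate — then some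
symmetric pencil on the same `d` has `20` distinct positive det-roots.  (Descartes with parity: `Var = #Z₊^{mult} + 2j`,
`Var ≤ 20`, `#Z₊^{mult} ≥ 19` force `#Z₊^{mult} = 20`.) [folklore] -/
theorem exists_twenty_of_nineteen_of_signVariations (d : Fin 6 → ℕ) (S : Fin 6 → Matrix (Fin 2) (Fin 2) ℝ)
    (hS : ∀ l, (S l).IsSymm) {f : ℝ[X]}
    (hf : f = ((∑ l, (X : ℝ[X]) ^ d l • (S l).map C)).det)
    (hZ : 19 ≤ (f.roots.toFinset.filter (fun t => 0 < t)).card) (hV : 20 ≤ f.signVariations) :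
    ∃ S' : Fin 6 → Matrix (Fin 2) (Fin 2) ℝ, (∀ l, (S' l).IsSymm) ∧
      20 ≤ ((((∑ l, (X : ℝ[X]) ^ d l • (S' l).map C)).det).roots.toFinset.filter (fun t => 0 < t)).card := by
  have hf0 : f ≠ 0 := by rintro rfl; simp at hZ
  refine exists_twenty_of_nineteen_of_countP d S hS hf hZ ?_
  obtain ⟨j, hj⟩ := Literature.Algebra.Polynomial.Descartes.signVariations_eq_countP_add_two_mul f
  have h1 := card_posRoots_le_countP_posRoots f
  have h2 := Literature.Computability.AlgebraicComplexity.signVariations_lt_card_support hf0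
  have h3 := card_support_det_two_six_le d S
  rw [← hf] at h3
  omega

/-- **DOOR-A READING of the A′ bridge (multiplicity).**  On a support `d` where the V = 20 row `PosRootLawOn 2 6 19 d` is
a theorem («no twenty on `d`»), a real symmetric pencil on `d` with `19` distinct positive det-roots has at most `19` of
them counted with multiplicity: a hypothetical nineteen on `d` has ONLY SIMPLE positive roots. [folklore] -/
theorem countP_le_nineteen_of_posRootLawOn {d : Fin 6 → ℕ} (hd : PosRootLawOn 2 6 19 d)
    (S : Fin 6 → Matrix (Fin 2) (Fin 2) ℝ) (hS : ∀ l, (S l).IsSymm) {f : ℝ[X]}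
    (hf : f = ((∑ l, (X : ℝ[X]) ^ d l • (S l).map C)).det)
    (hZ : 19 ≤ (f.roots.toFinset.filter (fun t => 0 < t)).card) :
    f.roots.countP (fun t => 0 < t) ≤ 19 := by
  by_contra h
  obtain ⟨S', hS', h20⟩ := exists_twenty_of_nineteen_of_countP d S hS hf hZ (by omega)
  have := hd S' hS'
  omega

/-- **DOOR-A READING of the A′ bridge (sign variations).**  On a support `d` where `PosRootLawOn 2 6 19 d` is a theorem,
a real symmetric pencil on `d` with `19` distinct positive det-roots has `Var(det) ≤ 19`: it is NOT fully alternating on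
`21` monomials — it is one-slack (sub-case A) or misses a pair sum (sub-cases B/C). [folklore] -/
theorem signVariations_le_nineteen_of_posRootLawOn {d : Fin 6 → ℕ} (hd : PosRootLawOn 2 6 19 d)
    (S : Fin 6 → Matrix (Fin 2) (Fin 2) ℝ) (hS : ∀ l, (S l).IsSymm) {f : ℝ[X]}
    (hf : f = ((∑ l, (X : ℝ[X]) ^ d l • (S l).map C)).det)
    (hZ : 19 ≤ (f.roots.toFinset.filter (fun t => 0 < t)).card) :
    f.signVariations ≤ 19 := by
  by_contra h
  obtain ⟨S', hS', h20⟩ := exists_twenty_of_nineteen_of_signVariations d S hS hf hZ (by omega)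
  have := hd S' hS'
  omega

end Summit.ValiantsHypothesis.ValiantsHypothesis.Theorems.LacunarySymmetroidMatrixDescartes.Census
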